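import Literature.IUT.HodgeTheaters.InitialThetaDataTorsionCuspModelDelta
import HarnessLib

/-!
# [IUTchI] §1 p.37 / Def 6.1 (v): the SINGLE-POINT cusp model `pedOf₄` — cusp inertia `⟨(e_{s(q)}, 1, 1)⟩` — and
# abc-iut-L5-t1's `CuspGalois` at it (NV-L5 row «JOINT-NV-CG (l cusps)», stage C part C1)

S. Mochizuki, *Inter-universal Teichmüller theory I*, kurims manuscript (May 2020), §1 p. 37 («the cusps of `X̲` … `ε⁰`
… `ε′, ε″`»), §1 p. 38 («by considering the decomposition groups associated to the cusps of `X̲` lying over `2ε`»),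
Def 6.1 (v) p. 158 («the subgroup `Aut_±(𝒟^{⊚±}) ⊆ Aut(𝒟^{⊚±}) ⥲ Aut(X̲_K)`», «automorphisms that fix the cusps of
`X̲_K`»).  PARAPHRASE (ours, not print's words): what this model realises is the subgroup `Π_{X̲_K}`, the decomposition
groups of the cusps, and automorphisms of `𝒟^{⊚±}` respecting them.  [claim: Mochizuki2012, status: disputed] (D-0012
claim key; series status DISPUTED — a MODEL of the cell's `π₁`-interface structures; nothing of the series is asserted;
no side taken on [IUTchIII] Cor. 3.12).

## WHY (memo HOME/staging/L5/L5-t8/g7/STEP0-jointNV-hS-singlepoint.md)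

Stage B (parts B1–B6, p454544 … p469075) inhabits `{CG, M′ ⊇ (M, hI), hL = ModLCuspLaws, hA = ArrowCoveringClaims}`
jointly at `regeom₃`, whose cusp inertia vectors are DIFFERENCES `e_{s(q)h} − e_{s(q)h⁻¹}`.  Those fix a cyclic ordering of
the `l` cusps (steps `[h] = [a]/2`), which is invariant under `E[l]/ℤ·g ⋊ {±1}` but NOT under the Borel torus of
`GL₂(𝔽_l)` acting on `E[l]/ℤ·g` through `G_F` — so abc-iut-L5-t4's `CuspClassesNormaliserStable` (`hS`) fails there.  The
SINGLE-POINT model replaces the inertia generator of the cusp `q` by `(e_{s(q)}, 1, 1)`: ONE basis vector of `U = 𝔽_l[E[l]]`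
at a section point, which every `σ` with `ρ(σ)(ℤ·g) = ℤ·g` maps to an `ℤ·g`-translate of another such vector.

## WHAT (this file; ambient of parts B1–B2 unchanged: `U`, `Del = U ⋊ E[l]`, `DihU = Del ⋊ {±1}`, `proj`, `dX`, `dC`,
`liftU`, `extK₃`, the cusps `E[l]/ℤ·g` and the affine `cuspAct`)

* `igenP s q := ((e_{s(q)}, 1), 1) ∈ DihU`; `outU_inr_e` (`(1,u)·e_P = e_{P^u}^{u}`), **`conj_igenP`**:
  `d·igenP_q·d⁻¹ = ((e_{s(q)^u t_d}^{u}, 1), 1)`; `base_eq_of_zpow_e_eq`;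
* **`pedOf₄ G g s a … : PuncturedEllipticData`** — `pedOf₃` with `decomp q := G × ⟨igenP_q⟩` (`ε⁰ = [1]`, `ε′ = [a]`,
  `ε″ = [a]⁻¹`, `2ε = [a]²`);
* **`cuspGalois₄ … : (pedOf₄ …).CuspGalois`** — all laws (`act := cuspAct ∘ proj ∘ snd`; `act_decomp` by `conj_igenP` and an
  `ℤ·g`-translation; `eq_of_conj` by supports).

HONEST LABEL «[model; `E[l]`-twisted finite shadow `U ⋊ E[l]`; `l` cusps; single-point inertia]»: this model has NO linear
relation among the `l` cusp classes (print has one; none of the typed laws sees it).  Model ≠ genuine datum; typed ≠ proved;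
no side taken on [IUTchIII] Cor. 3.12.
-/

noncomputable section

namespace Literature.IUT.HodgeTheaters

universe u

namespace TorsionCuspModel
open Literature.AnabelianGeometry.AbsoluteAnabelian Topology TorsionMonodromyModel
open Literature.AnabelianGeometry.EtaleTheta.SettingModel
open scoped WeierstrassCurve.Affine Classical Pointwise

variable {F : Type u} [Field F] {E : WeierstrassCurve F} {Fbar : Type u} [Field Fbar] [Algebra F Fbar] {l : ℕ}

/-! ## Single-point inertia generators -/

/-- **The single-point inertia generator of the cusp `q`**: `((e_{s(q)}, 1), 1) ∈ DihU` for a section `s` of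
`E[l] ↠ E[l]/ℤ·g`. [cite: Mochizuki2012, IUTchI §1 p.37] -/
def igenP {g : Tors E Fbar l} (s : Tors E Fbar l ⧸ Subgroup.zpowers g → Tors E Fbar l)
    (q : Tors E Fbar l ⧸ Subgroup.zpowers g) : DihU F E Fbar l :=
  SemidirectProduct.inl (SemidirectProduct.inl (U.e (s q)))

/-- [cite: Mochizuki2012, IUTchI §1 p.37] -/
@[simp] theorem igenP_right {g : Tors E Fbar l} (s : Tors E Fbar l ⧸ Subgroup.zpowers g → Tors E Fbar l)
    (q : Tors E Fbar l ⧸ Subgroup.zpowers g) : (igenP (F := F) s q).right = 1 := rfl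

/-- [cite: Mochizuki2012, IUTchI §1 p.37] -/
@[simp] theorem igenP_left_right {g : Tors E Fbar l} (s : Tors E Fbar l ⧸ Subgroup.zpowers g → Tors E Fbar l)
    (q : Tors E Fbar l ⧸ Subgroup.zpowers g) : (igenP (F := F) s q).left.right = 1 := rfl

/-- `igenP_q = embU (e_{s q})` on the finite factor. [cite: Mochizuki2012, IUTchI §1 p.37] -/
theorem embU_e_snd (G : Type u) [Group G] {g : Tors E Fbar l} (s : Tors E Fbar l ⧸ Subgroup.zpowers g → Tors E Fbar l)
    (q : Tors E Fbar l ⧸ Subgroup.zpowers g) : (embU (F := F) G (U.e (s q))).2 = igenP s q := rfl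

/-- The involution side acts on basis vectors by `(1, u)·e_P = e_{P^u}^{u}` (inversion of the point, sign `ε(u) = u`).
[cite: Mochizuki2012, IUTchI §1 p.38] -/
theorem outU_inr_e (u : ℤˣ) (P : Tors E Fbar l) : outU E l (1, u) (U.e P) = U.e (P ^ (u : ℤ)) ^ (u : ℤ) := by
  refine U.ext fun Q => ?_
  rw [toAdd_outU_apply, act_inr_symm_apply, U.toAdd_e_apply, toAdd_zpow, Pi.smul_apply, U.toAdd_e_apply, smul_ite,
    smul_zero, zsmul_eq_mul, mul_one]
  rcases Int.units_eq_one_or u with rfl | rfl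
  · simp only [sgnScalar, Units.val_one, Int.cast_one, one_mul, zpow_one]
  · simp only [sgnScalar, Units.val_neg, Units.val_one, Int.cast_neg, Int.cast_one, zpow_neg, zpow_one, inv_eq_iff_eq_inv,
      mul_ite, mul_one, mul_zero]

/-- **`d · igenP_q · d⁻¹ = ((e_{s(q)^u · t_d}^{u}, 1), 1)`** for `d = ⟨⟨f, t_d⟩, u⟩`: conjugation moves the single-point
vector to the point `s(q)^u t_d` over the cusp `act d q`. [cite: Mochizuki2012, IUTchI §1 p.37] -/
theorem conj_igenP {g : Tors E Fbar l} (s : Tors E Fbar l ⧸ Subgroup.zpowers g → Tors E Fbar l)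
    (q : Tors E Fbar l ⧸ Subgroup.zpowers g) (d : DihU F E Fbar l) :
    d * igenP (F := F) s q * d⁻¹ =
      SemidirectProduct.inl (SemidirectProduct.inl (U.e ((s q) ^ (d.right : ℤ) * d.left.right) ^ (d.right : ℤ))) := by
  rw [igenP, conj_inl_inl, outU_inr_e, map_zpow, transl_e]

/-- Supports: `e_b ^ n = e_{b'}` forces `b = b'`. [cite: Mochizuki2012, IUTchI §1 p.37] -/
theorem base_eq_of_zpow_e_eq (hl : l.Prime) {b b' : Tors E Fbar l} {n : ℤ} (hn : U.e b ^ n = U.e b') : b = b' := by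
  haveI : Fact (1 < l) := ⟨hl.one_lt⟩
  by_contra hne
  have := congrArg (fun f : U E Fbar l => Multiplicative.toAdd f b') hn
  simp only [toAdd_zpow, Pi.smul_apply, U.toAdd_e_apply, if_neg (Ne.symm hne), smul_zero] at this
  exact zero_ne_one this

/-- `⟨x ^ u⟩ = ⟨x⟩` for `u = ±1`. [cite: Mochizuki2012, IUTchI §1 p.37] -/
theorem zpowers_zpow_units {H : Type u} [Group H] (x : H) (u : ℤˣ) : Subgroup.zpowers (x ^ (u : ℤ)) = Subgroup.zpowers x := by
  rcases Int.units_eq_one_or u with rfl | rfl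
  · rw [Units.val_one, zpow_one]
  · rw [Units.val_neg, Units.val_one, zpow_neg, zpow_one, Subgroup.zpowers_inv]

/-! ## The single-point `K`-level datum `pedOf₄` -/

section Datum

variable (F E Fbar l)
variable (G : Type u) [Group G] [TopologicalSpace G] [IsTopologicalGroup G] [CompactSpace G]
  [TotallyDisconnectedSpace G] [E.IsElliptic] [NeZero l]

/-- **The single-point `K`-level §1 datum**: `Π_C := G × DihU`, `Π_X := G × dX`, `Π_{C̲} := G × dC g`, cusps `E_F[l]/ℤ·g`
with decomposition groups `D_q := G × ⟨igenP_q⟩`, `ε⁰ := [1]`, `ε′ := [a]`, `ε″ := [a]⁻¹`, `2ε := [a]²` (`a ∉ ℤ·g`).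
[cite: Mochizuki2012, IUTchI §1 p.37] -/
def pedOf₄ (g : Tors E Fbar l) (s : Tors E Fbar l ⧸ Subgroup.zpowers g → Tors E Fbar l) (a : Tors E Fbar l)
    (hl : l.Prime) (ha : a ∉ Subgroup.zpowers g) (h5 : 5 ≤ l) (h6 : l.Coprime 6) : PuncturedEllipticData.{u} :=
  haveI : Fact l.Prime := ⟨hl⟩
  let abar : Tors E Fbar l ⧸ Subgroup.zpowers g := QuotientGroup.mk a
  have habar : abar ≠ 1 := fun h1 => ha ((QuotientGroup.eq_one_iff a).mp h1)
  have hpow : abar ^ l = 1 := by rw [← QuotientGroup.mk_pow, Tors.pow_l, QuotientGroup.mk_one]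
  have hord : orderOf abar = l := orderOf_eq_prime hpow habar
  have hdvd : ∀ n : ℕ, abar ^ n = 1 → l ∣ n := fun n hn => hord ▸ orderOf_dvd_of_pow_eq_one hn
  { pedOf₃ F E Fbar l G g s 1 a hl ha h5 h6 with
    Cusp := Tors E Fbar l ⧸ Subgroup.zpowers g
    decomp := fun q => liftU G (Subgroup.zpowers (igenP (F := F) s q))
    decomp_le := fun q => le_inf
      (liftU_mono G (Subgroup.zpowers_le.mpr
        (show igenP (F := F) s q ∈ dX F E Fbar l from (mem_dX_iff _).mpr rfl)))
      (liftU_mono G (Subgroup.zpowers_le.mpr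
        (show igenP (F := F) s q ∈ dC F E g from by rw [mem_dC_iff, igenP_left_right]; exact one_mem _)))
    ε0 := 1
    ε1 := abar
    ε2 := abar⁻¹
    twoε := abar ^ 2
    ε1_ne_ε0 := habar
    ε2_ne_ε0 := inv_ne_one.mpr habar
    ε1_ne_ε2 := by
      intro h12
      have h2 : abar ^ 2 = 1 := by
        calc abar ^ 2 = abar * abar⁻¹ := by rw [pow_two, ← h12]
          _ = 1 := mul_inv_cancel abar
      have := Nat.le_of_dvd two_pos (hdvd 2 h2); omega
    twoε_ne := by
      refine ⟨fun h2 => ?_, fun h21 => ?_, fun h22 => ?_⟩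
      · have := Nat.le_of_dvd two_pos (hdvd 2 h2); omega
      · apply habar
        have : abar ^ 2 = abar ^ 1 := by rw [h21, pow_one]
        rw [pow_two, pow_one] at this
        exact mul_left_cancel (a := abar) (by rw [this, mul_one])
      · have h3 : abar ^ 3 = 1 := by rw [pow_succ, h22, inv_mul_cancel]
        have := Nat.le_of_dvd three_pos (hdvd 3 h3); omega
    aug_decomp_twoε := fst_liftU_surjective G _ }

end Datum

/-! ## The cusp Galois action at `pedOf₄` -/

section CuspGalois

variable (G : Type u) [Group G] [TopologicalSpace G] [IsTopologicalGroup G] [CompactSpace G]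
  [TotallyDisconnectedSpace G] [E.IsElliptic] [NeZero l]
  {g : Tors E Fbar l} (s : Tors E Fbar l ⧸ Subgroup.zpowers g → Tors E Fbar l) (a : Tors E Fbar l)
  (hl : l.Prime) (ha : a ∉ Subgroup.zpowers g) (h5 : 5 ≤ l) (h6 : l.Coprime 6)

/-- **abc-iut-L5-t1's `CuspGalois` INHABITED at the single-point datum `pedOf₄`** (the affine action
`⟨t, u⟩ · q = [t] · q^u` of `Π_{C_K} = G × DihU` on `E_F[l]/ℤ·g`; all laws). [cite: Mochizuki2012, IUTchI §1 p.37] -/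
def cuspGalois₄ (hg : g ≠ 1) (hcard : Nat.card (Tors E Fbar l) = l ^ 2)
    (hs : ∀ q : Tors E Fbar l ⧸ Subgroup.zpowers g, (QuotientGroup.mk (s q) : _ ⧸ Subgroup.zpowers g) = q) :
    (pedOf₄ F E Fbar l G g s a hl ha h5 h6).CuspGalois :=
  haveI : Fact l.Prime := ⟨hl⟩
  let D := pedOf₄ F E Fbar l G g s a hl ha h5 h6
  let actK : (G × DihU F E Fbar l) →* Equiv.Perm (Tors E Fbar l ⧸ Subgroup.zpowers g) :=
    (cuspAct g).comp ((proj F E Fbar l).comp (MonoidHom.snd G (DihU F E Fbar l)))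
  have actK_apply : ∀ (x : G × DihU F E Fbar l) (q : Tors E Fbar l ⧸ Subgroup.zpowers g),
      actK x q = (QuotientGroup.mk x.2.left.right : _ ⧸ Subgroup.zpowers g) * q ^ (x.2.right : ℤ) := fun _ _ => rfl
  -- the point of `d · igenP_q · d⁻¹` lies over the cusp `act d q`
  have hbase : ∀ (d : DihU F E Fbar l) (q : Tors E Fbar l ⧸ Subgroup.zpowers g),
      (QuotientGroup.mk ((s q) ^ (d.right : ℤ) * d.left.right) : _ ⧸ Subgroup.zpowers g) = actK (1, d) q :=
    fun d q => by rw [actK_apply, QuotientGroup.mk_mul, QuotientGroup.mk_zpow, hs, mul_comm]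
  { act := actK
    act_decomp := fun x q => by
      -- `x·D_q·x⁻¹` is generated by `e_b^{u}`, `b := s(q)^{u_x}·t_x` over `act x q`; correct by `t₀ := b·s(act x q)⁻¹ ∈ ℤ·g`
      obtain ⟨b, hbdef⟩ : ∃ b : Tors E Fbar l, b = (s q) ^ (x.2.right : ℤ) * x.2.left.right := ⟨_, rfl⟩
      have hb : (QuotientGroup.mk b : _ ⧸ Subgroup.zpowers g) = actK x q := by rw [hbdef]; exact hbase x.2 q
      obtain ⟨t₀, ht₀def⟩ : ∃ t₀ : Tors E Fbar l, t₀ = b * (s (actK x q))⁻¹ := ⟨_, rfl⟩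
      have ht₀ : t₀ ∈ Subgroup.zpowers g := by
        rw [ht₀def, ← QuotientGroup.eq_one_iff, QuotientGroup.mk_mul, QuotientGroup.mk_inv, hb, hs, mul_inv_cancel]
      obtain ⟨d, hddef⟩ : ∃ d : DihU F E Fbar l, d = SemidirectProduct.inl (SemidirectProduct.inr t₀⁻¹) := ⟨_, rfl⟩
      have hd1 : d.right = 1 := by rw [hddef, SemidirectProduct.right_inl]
      have hd2 : d.left.right = t₀⁻¹ := by rw [hddef, SemidirectProduct.left_inl, SemidirectProduct.right_inr]
      let t : D.PiC := ((1 : G), d)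
      refine ⟨t, ⟨mem_liftU.mpr ((mem_dX_iff _).mpr hd1),
        mem_liftU.mpr ((mem_dC_iff _ _).mpr (hd2 ▸ Subgroup.inv_mem _ ht₀))⟩, ?_⟩
      show MulAut.conj (G := G × DihU F E Fbar l) (t * x) • liftU G (Subgroup.zpowers (igenP (F := F) s q)) =
        liftU G (Subgroup.zpowers (igenP (F := F) s (actK x q)))
      rw [conj_smul_liftU, conj_smul_zpowers]
      congr 1
      have key : (t * x).2 * igenP (F := F) s q * ((t * x).2)⁻¹ = igenP (F := F) s (actK x q) ^ (x.2.right : ℤ) := by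
        show d * x.2 * igenP (F := F) s q * (d * x.2)⁻¹ = igenP (F := F) s (actK x q) ^ (x.2.right : ℤ)
        calc d * x.2 * igenP (F := F) s q * (d * x.2)⁻¹ = d * (x.2 * igenP (F := F) s q * x.2⁻¹) * d⁻¹ := by group
          _ = SemidirectProduct.inl (SemidirectProduct.inl (U.e (b * t₀⁻¹) ^ (x.2.right : ℤ))) := by
            rw [conj_igenP, map_zpow, map_zpow, ← hbdef, ← map_zpow, ← map_zpow, conj_inl_inl, hd1, hd2, Prod.mk_one_one,
              outU_one, MulAut.one_apply, map_zpow, transl_e]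
          _ = igenP (F := F) s (actK x q) ^ (x.2.right : ℤ) := by
            rw [igenP, ← map_zpow, ← map_zpow, ht₀def, mul_inv_rev, inv_inv, mul_comm (s (actK x q)) b⁻¹,
              mul_inv_cancel_left]
      rw [key, zpowers_zpow_units]
    eq_of_conj := fun q q' t ht hconj => by
      have ht1 : t.2.right = 1 := (mem_dX_iff _).mp (mem_liftU.mp ht.1)
      have ht2 : t.2.left.right ∈ Subgroup.zpowers g := (mem_dC_iff _ _).mp (mem_liftU.mp ht.2)
      have h1 : Subgroup.zpowers (t.2 * igenP (F := F) s q * t.2⁻¹) = Subgroup.zpowers (igenP (F := F) s q') := by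
        apply liftU_injective G
        rw [← conj_smul_zpowers, ← conj_smul_liftU]
        exact hconj
      rw [conj_igenP, ht1, Units.val_one, zpow_one, zpow_one] at h1
      have hmem : igenP (F := F) s q' ∈
          Subgroup.zpowers (SemidirectProduct.inl (SemidirectProduct.inl (U.e (s q * t.2.left.right))) : DihU F E Fbar l) := by
        rw [h1]; exact Subgroup.mem_zpowers _
      obtain ⟨n, hn⟩ := Subgroup.mem_zpowers_iff.mp hmem
      rw [igenP, ← map_zpow, ← map_zpow] at hn
      have hb := base_eq_of_zpow_e_eq hl (SemidirectProduct.inl_injective (SemidirectProduct.inl_injective hn))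
      rw [← hs q, ← hs q', ← hb, QuotientGroup.mk_mul, (QuotientGroup.eq_one_iff _).mpr ht2, mul_one]
    isClosed_decomp := fun q => isClosed_liftU G _
    free := fun x hx (q : Tors E Fbar l ⧸ Subgroup.zpowers g) hq => by
      have hu : x.2.right = 1 := (mem_dX_iff _).mp (mem_liftU.mp hx)
      refine ⟨hx, mem_liftU.mpr ((mem_dC_iff _ _).mpr ?_)⟩
      have this : (QuotientGroup.mk x.2.left.right : _ ⧸ Subgroup.zpowers g) * q ^ (x.2.right : ℤ) = q := hq
      rw [hu, Units.val_one, zpow_one, mul_eq_right] at this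
      exact (QuotientGroup.eq_one_iff _).mp this
    transitive := fun (q q' : Tors E Fbar l ⧸ Subgroup.zpowers g) => by
      refine ⟨((1 : G), SemidirectProduct.inl (SemidirectProduct.inr (s q' * (s q)⁻¹))),
        mem_liftU.mpr ((mem_dX_iff _).mpr rfl), ?_⟩
      show (QuotientGroup.mk (s q' * (s q)⁻¹) : _ ⧸ Subgroup.zpowers g) * q ^ ((1 : ℤˣ) : ℤ) = q'
      rw [Units.val_one, zpow_one, QuotientGroup.mk_mul, QuotientGroup.mk_inv, hs, hs, inv_mul_cancel_right]
    exists_generator := by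
      let φ : Tors E Fbar l →* G × DihU F E Fbar l :=
        (MonoidHom.inr G (DihU F E Fbar l)).comp (SemidirectProduct.inl.comp SemidirectProduct.inr)
      have hφX : ∀ t, φ t ∈ liftU G (dX F E Fbar l) := fun t => mem_liftU.mpr ((mem_dX_iff _).mpr rfl)
      have hφact : ∀ (t : Tors E Fbar l) (q : Tors E Fbar l ⧸ Subgroup.zpowers g),
          actK (φ t) q = (QuotientGroup.mk t : _ ⧸ Subgroup.zpowers g) * q := fun t q => by
        rw [actK_apply]
        show (QuotientGroup.mk t : _ ⧸ Subgroup.zpowers g) * q ^ ((1 : ℤˣ) : ℤ) = _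
        rw [Units.val_one, zpow_one]
      refine ⟨φ a, hφX a, fun x hx => ?_⟩
      have hu : x.2.right = 1 := (mem_dX_iff _).mp (mem_liftU.mp hx)
      have habar : (QuotientGroup.mk a : _ ⧸ Subgroup.zpowers g) ≠ 1 :=
        fun h1 => ha ((QuotientGroup.eq_one_iff a).mp h1)
      have hcardQ : Nat.card (Tors E Fbar l ⧸ Subgroup.zpowers g) = l := by
        have h1 := (Subgroup.zpowers g).card_mul_index
        rw [Tors.card_zpowers hl hg, hcard, sq, Subgroup.index] at h1
        exact Nat.eq_of_mul_eq_mul_left hl.pos h1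
      obtain ⟨n, hn⟩ := Subgroup.mem_zpowers_iff.mp
        (mem_zpowers_of_prime_card hcardQ habar (g' := (QuotientGroup.mk x.2.left.right : _ ⧸ Subgroup.zpowers g)))
      have e : actK (φ a) ^ n = actK (φ (a ^ n)) :=
        ((congrArg actK (map_zpow φ a n)).trans (map_zpow actK (φ a) n)).symm
      refine ⟨n, ?_⟩
      show actK x = actK (φ a) ^ n
      rw [e]
      ext q
      rw [actK_apply, hu, Units.val_one, zpow_one, hφact, QuotientGroup.mk_zpow, hn]
    conj_mul_mem_PiXbar := fun c hc hcX x hx => by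
      have hcu : c.2.right ≠ 1 := fun h1 => hcX (mem_liftU.mpr ((mem_dX_iff _).mpr h1))
      have hcu' : c.2.right = -1 := (Int.units_eq_one_or c.2.right).resolve_left hcu
      have hxu : x.2.right = 1 := (mem_dX_iff _).mp (mem_liftU.mp hx)
      refine ⟨mem_liftU.mpr ((mem_dX_iff _).mpr ?_), mem_liftU.mpr ((mem_dC_iff _ _).mpr ?_)⟩
      · show (c.2 * x.2 * c.2⁻¹ * x.2).right = 1
        rw [SemidirectProduct.mul_right, SemidirectProduct.mul_right, SemidirectProduct.mul_right,
          SemidirectProduct.inv_right, hcu', hxu, mul_one, mul_one, mul_inv_cancel]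
      · have key : (proj F E Fbar l (c.2 * x.2 * c.2⁻¹ * x.2)).left = 1 := by
          rw [map_mul, map_mul, map_mul, map_inv]
          simp only [SemidirectProduct.mul_left, SemidirectProduct.inv_left, SemidirectProduct.mul_right,
            SemidirectProduct.inv_right, proj_apply_right, hcu', hxu, mul_one, Int.units_inv_eq_self,
            Int.units_mul_self, map_one, MulAut.one_apply, sgnRep_apply_eq_zpow, Units.val_neg, Units.val_one,
            zpow_neg, zpow_one, inv_inv]
          rw [mul_comm _ (proj F E Fbar l c.2).left⁻¹, inv_mul_cancel_left, inv_mul_cancel]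
        show (c.2 * x.2 * c.2⁻¹ * x.2).left.right ∈ Subgroup.zpowers g
        rw [← proj_apply_left, key]
        exact one_mem _
    act_ε0 := fun c hc => by
      have hcL : c.2.left.right ∈ Subgroup.zpowers g := (mem_dC_iff _ _).mp (mem_liftU.mp hc)
      show (QuotientGroup.mk c.2.left.right : _ ⧸ Subgroup.zpowers g) * 1 ^ (c.2.right : ℤ) = 1
      rw [one_zpow, mul_one]
      exact (QuotientGroup.eq_one_iff _).mpr hcL
    act_ε1 := fun c hc hcX => by
      have hcL : c.2.left.right ∈ Subgroup.zpowers g := (mem_dC_iff _ _).mp (mem_liftU.mp hc)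
      have hcu : c.2.right ≠ 1 := fun h1 => hcX (mem_liftU.mpr ((mem_dX_iff _).mpr h1))
      have hcu' : c.2.right = -1 := (Int.units_eq_one_or c.2.right).resolve_left hcu
      show (QuotientGroup.mk c.2.left.right : _ ⧸ Subgroup.zpowers g) *
          (QuotientGroup.mk a : Tors E Fbar l ⧸ Subgroup.zpowers g) ^ (c.2.right : ℤ) =
        (QuotientGroup.mk a : Tors E Fbar l ⧸ Subgroup.zpowers g)⁻¹
      rw [hcu', Units.val_neg, Units.val_one, zpow_neg, zpow_one, (QuotientGroup.eq_one_iff _).mpr hcL, one_mul]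
    act_twoε := fun x hx hx0 => by
      left
      have hu : x.2.right = 1 := (mem_dX_iff _).mp (mem_liftU.mp hx)
      have h0 : (QuotientGroup.mk x.2.left.right : _ ⧸ Subgroup.zpowers g) * 1 ^ (x.2.right : ℤ) =
        QuotientGroup.mk a := hx0
      rw [one_zpow, mul_one] at h0
      show (QuotientGroup.mk (x.2 * x.2).left.right : _ ⧸ Subgroup.zpowers g) * 1 ^ ((x.2 * x.2).right : ℤ) =
        QuotientGroup.mk a ^ 2
      rw [one_zpow, mul_one, SemidirectProduct.mul_left, hu, map_one, MulAut.one_apply, SemidirectProduct.mul_right,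
        QuotientGroup.mk_mul, h0, pow_two] }

end CuspGalois

end TorsionCuspModel

end Literature.IUT.HodgeTheaters

end
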